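import Literature.NumberTheory.Transcendental.ParameterFamily
import HarnessLib

/-!
# The exponent inequality of the numerical condition along the parameter family

Topic: `Literature/NumberTheory/Transcendental`. Plan item W4 (parameter choice, part 2b, the
pure-ℕ core) of the unit `provefact-Literature.NumberTheory.Transcendental.H-b596640137`. With
the two-base envelopes of `NumCondEnvelopes.lean` (`G ≤ σ`, `W = σ^{an+1}`, saving factor
`σ^{-b(T-T')(S₀+1)}`), the numerical condition `NumCond₂` along the family of
`ParameterFamily.lean` reduces to ONE inequality between natural numbers,
`X₁ + (an+1)·X₂ + Y < b·(T - T')·(S₀ + 1)`, where `X₁, X₂, Y` are the explicit exponent sums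
(`BakerData.Family.X₁/X₂/Y` below, literally the exponents produced by the envelopes). PROVED:
`BakerData.Family.exponent_ineq` — it holds for all `σ ≥ σ₀` provided `b ≥ b₀(h, n, ℓ, hdeg, dd)`
(`Family.b₀`) and `a·(n - dd) ≥ 2b + 2n + 4`; every size is dominated by an explicit multiple of
`σ^{(a+1)n}` and the coefficients are compared.

## References

* A. Baker, G. Wüstholz, *Logarithmic Forms and Diophantine Geometry*, CUP 2007, §6.8 (p. 119).
-/

namespace Literature.NumberTheory.Transcendental

namespace GaGmE

namespace Std

namespace BakerData

namespace Family

variable (F : Family) (n dd h hdeg G' : ℕ)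

/-! ### The sizes along the family (upper bounds as naturals) -/

/-- `κ_D = n·2(4n)^{dd}`, so that `D = nD' = κ_D σ^{1+a·dd}`. [folklore] -/
def κD : ℕ := n * (2 * (4 * n) ^ dd)

/-- `D = n D'`. [folklore] -/
def Dn (σ : ℕ) : ℕ := n * F.D' n dd σ

/-- `T' = n T″ + 1`. [folklore] -/
def T' (σ : ℕ) : ℕ := n * F.T₂ n σ + 1

/-- `S₁ = n S`. [folklore] -/
def S₁ (σ : ℕ) : ℕ := n * F.S n σ

/-- `R' = 2(nℓ+1) σ^{b+n} ≥ R`. [folklore] -/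
def R' (σ : ℕ) : ℕ := 2 * (n * F.ℓ + 1) * σ ^ (F.b + n)

/-- `E_T = expE D T = 2D + 3T + (D·hdeg + 2T)`. [folklore] -/
def ET (σ : ℕ) : ℕ := 2 * F.Dn n dd σ + F.T n σ * 3 + (F.Dn n dd σ * hdeg + 2 * F.T n σ)

/-- `E' = expE D T'`. [folklore] -/
def E' (σ : ℕ) : ℕ := 2 * F.Dn n dd σ + F.T' n σ * 3 + (F.Dn n dd σ * hdeg + 2 * F.T' n σ)

/-- `P₁ = D·hdeg + 2T'`. [folklore] -/
def P₁ (σ : ℕ) : ℕ := F.Dn n dd σ * hdeg + 2 * F.T' n σ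

/-- `NA₁`, the `G`-exponent of the house bound. [folklore] -/
def NA₁ (σ : ℕ) : ℕ := (S₀ n σ + 1) * F.ET n dd hdeg σ + 2 * F.T n σ + F.Dn n dd σ +
  (S₀ n σ + 1) * (F.Dn n dd σ * hdeg + 2 * F.T n σ)

/-- `NA₂`, the `W`-exponent of the house bound. [folklore] -/
def NA₂ (σ : ℕ) : ℕ := F.T n σ + (F.Dn n dd σ * hdeg + 2 * F.T n σ)

/-- `L₁`, the `G`-exponent of `Λ` (without `A`). [folklore] -/
def L₁ (σ : ℕ) : ℕ := 2 * F.T' n σ + 3 + F.Dn n dd σ + (F.S₁ n σ + 1) * F.P₁ n dd hdeg σ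

/-- `L₂`, the `W`-exponent of `Λ` (without `A`). [folklore] -/
def L₂ (σ : ℕ) : ℕ := 2 * F.T' n σ + 3 * n + F.P₁ n dd hdeg σ

/-- **`X₁`**, the total `G`-exponent of the left-hand side. [folklore] -/
def X₁ (σ : ℕ) : ℕ := 2 * F.T' n σ + 3 + F.Dn n dd σ * (1 + (F.R' n σ + 1) ^ 2 * G' ^ 2) +
  h * ((F.S₁ n σ + 1) * F.E' n dd hdeg σ) + (h - 1) * F.L₁ n dd hdeg σ + h * F.NA₁ n dd hdeg σ

/-- **`X₂`**, the total `W`-exponent of the left-hand side. [folklore] -/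
def X₂ (σ : ℕ) : ℕ := 2 * F.T' n σ + n + 2 * n + (h - 1) * F.L₂ n dd hdeg σ + h * F.NA₂ n dd hdeg σ

/-- **`Y`**, the `G`-exponent of the right-hand side. [folklore] -/
def Y (σ : ℕ) : ℕ := F.Dn n dd σ * (2 + F.S₁ n σ ^ 2)

/-- **`Msave`**, the exponent of the saving factor. [folklore] -/
def Msave (σ : ℕ) : ℕ := (F.T n σ - F.T' n σ) * (S₀ n σ + 1)

/-- **The required lower bound `b₀` on `b`** (coefficient comparison at degree `(a+1)n`). [folklore] -/
def b₀ : ℕ := 4 * n + 6 + h * (n * F.ℓ + 1) * ((2 + hdeg) * κD n dd + 10 * n) +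
  h * (4 * n + 3 + κD n dd + (n * F.ℓ + 1) * (hdeg * κD n dd + 4 * n)) +
  h * ((2 + hdeg) * κD n dd + 20 * n + 8 * n + κD n dd + hdeg * κD n dd + 8 * n)

/-! ### Size bounds along the family -/

variable {n dd}

/-- `D = κ_D σ^{1 + a·dd}`. [folklore] -/
theorem Dn_eq (σ : ℕ) : F.Dn n dd σ = κD n dd * σ ^ (1 + F.a * dd) := by
  unfold Dn D' κD; ring

/-- `T' ≤ 2n σ^{an}` (`n, σ ≥ 1`). [folklore] -/
theorem T'_le (hn : 1 ≤ n) {σ : ℕ} (hσ : 1 ≤ σ) : F.T' n σ ≤ 2 * n * σ ^ (F.a * n) := by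
  unfold T' T₂
  have hpos : 1 ≤ σ ^ (F.a * n) := Nat.one_le_pow _ σ hσ
  have : n * (2 * σ ^ (F.a * n) - 1) + 1 ≤ n * (2 * σ ^ (F.a * n)) := by
    rw [Nat.mul_sub, mul_one]
    have : n ≤ n * (2 * σ ^ (F.a * n)) := Nat.le_mul_of_pos_right n (by omega)
    omega
  linarith

/-- `S₁ + 1 ≤ (nℓ + 1) σ^n` (`σ ≥ 1`). [folklore] -/
theorem S₁_add_one_le {σ : ℕ} (hσ : 1 ≤ σ) : F.S₁ n σ + 1 ≤ (n * F.ℓ + 1) * σ ^ n := by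
  unfold S₁ S
  have := Nat.one_le_pow n σ hσ
  nlinarith

/-- `σ^{1 + a·dd} ≤ σ^{an}` when `a(n - dd) ≥ 1` (i.e. `1 + a·dd ≤ a·n`). [folklore] -/
theorem pow_D_le {σ : ℕ} (hσ : 1 ≤ σ) (hexp : 1 + F.a * dd ≤ F.a * n) : σ ^ (1 + F.a * dd) ≤ σ ^ (F.a * n) :=
  Nat.pow_le_pow_right hσ hexp

/-- `T - T' ≥ 2n σ^{an}` (`n, σ ≥ 1`). [folklore] -/
theorem two_n_pow_le_T_sub (hn : 1 ≤ n) {σ : ℕ} (hσ : 1 ≤ σ) : 2 * n * σ ^ (F.a * n) ≤ F.T n σ - F.T' n σ := by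
  have h := F.orders_le n hn hσ
  unfold T'
  unfold T at *
  set x := σ ^ (F.a * n) with hx
  have e : 4 * n * x / 2 = 2 * n * x := by
    rw [show 4 * n * x = 2 * (2 * n * x) by ring, Nat.mul_div_cancel_left _ two_pos]
  rw [e] at h
  have e2 : 4 * n * x = 2 * n * x + 2 * n * x := by ring
  omega

/-- A linear-in-`σ^{an}` size: `c₁·D + c₂·T-type ≤ (c₁ κ_D + c₂·4n) σ^{an}`. [folklore] -/
theorem lin_le {σ : ℕ} (hσ : 1 ≤ σ) (hexp : 1 + F.a * dd ≤ F.a * n) (c₁ c₂ : ℕ) :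
    c₁ * F.Dn n dd σ + c₂ * F.T n σ ≤ (c₁ * κD n dd + c₂ * (4 * n)) * σ ^ (F.a * n) := by
  rw [F.Dn_eq]
  unfold T
  have h1 := Nat.mul_le_mul_left (c₁ * κD n dd) (F.pow_D_le hσ hexp)
  nlinarith [h1]

/-- The same with `T'` (`T' ≤ 2nσ^{an}`). [folklore] -/
theorem lin_le' (hn : 1 ≤ n) {σ : ℕ} (hσ : 1 ≤ σ) (hexp : 1 + F.a * dd ≤ F.a * n) (c₁ c₂ : ℕ) :
    c₁ * F.Dn n dd σ + c₂ * F.T' n σ ≤ (c₁ * κD n dd + c₂ * (2 * n)) * σ ^ (F.a * n) := by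
  rw [F.Dn_eq]
  have hT := Nat.mul_le_mul_left c₂ (F.T'_le hn hσ)
  have h1 := Nat.mul_le_mul_left (c₁ * κD n dd) (F.pow_D_le hσ hexp)
  nlinarith [h1, hT]

/-- `E_T ≤ ((2+hdeg)κ_D + 20n) σ^{an}`. [folklore] -/
theorem ET_le {σ : ℕ} (hσ : 1 ≤ σ) (hexp : 1 + F.a * dd ≤ F.a * n) :
    F.ET n dd hdeg σ ≤ ((2 + hdeg) * κD n dd + 20 * n) * σ ^ (F.a * n) := by
  have h := F.lin_le hσ hexp (2 + hdeg) 5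
  unfold ET
  nlinarith [h]

/-- `E' ≤ ((2+hdeg)κ_D + 10n) σ^{an}`. [folklore] -/
theorem E'_le (hn : 1 ≤ n) {σ : ℕ} (hσ : 1 ≤ σ) (hexp : 1 + F.a * dd ≤ F.a * n) :
    F.E' n dd hdeg σ ≤ ((2 + hdeg) * κD n dd + 10 * n) * σ ^ (F.a * n) := by
  have h := F.lin_le' hn hσ hexp (2 + hdeg) 5
  unfold E'
  nlinarith [h]

/-- `P₁ ≤ (hdeg κ_D + 4n) σ^{an}`. [folklore] -/
theorem P₁_le (hn : 1 ≤ n) {σ : ℕ} (hσ : 1 ≤ σ) (hexp : 1 + F.a * dd ≤ F.a * n) :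
    F.P₁ n dd hdeg σ ≤ (hdeg * κD n dd + 4 * n) * σ ^ (F.a * n) := by
  have h := F.lin_le' hn hσ hexp hdeg 2
  unfold P₁
  nlinarith [h]

/-- `D·hdeg + 2T ≤ (hdeg κ_D + 8n) σ^{an}`. [folklore] -/
theorem DT_le {σ : ℕ} (hσ : 1 ≤ σ) (hexp : 1 + F.a * dd ≤ F.a * n) :
    F.Dn n dd σ * hdeg + 2 * F.T n σ ≤ (hdeg * κD n dd + 8 * n) * σ ^ (F.a * n) := by
  have h := F.lin_le hσ hexp hdeg 2
  nlinarith [h]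

/-- `NA₁ ≤ c · σ^{(a+1)n}` with `c = (2+hdeg)κ_D + 20n + 8n + κ_D + hdeg κ_D + 8n`. [folklore] -/
theorem NA₁_le {σ : ℕ} (hσ : 1 ≤ σ) (hexp : 1 + F.a * dd ≤ F.a * n) :
    F.NA₁ n dd hdeg σ ≤ ((2 + hdeg) * κD n dd + 20 * n + 8 * n + κD n dd + hdeg * κD n dd + 8 * n) *
      σ ^ ((F.a + 1) * n) := by
  have h1 := F.ET_le (hdeg := hdeg) hσ hexp
  have h2 := F.DT_le (hdeg := hdeg) hσ hexp
  have h3 : F.Dn n dd σ ≤ κD n dd * σ ^ (F.a * n) := by rw [F.Dn_eq]; exact Nat.mul_le_mul_left _ (F.pow_D_le hσ hexp)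
  have h4 : F.T n σ = 4 * n * σ ^ (F.a * n) := rfl
  have hS : S₀ n σ + 1 = σ ^ n := S₀_add_one n hσ
  have hpow : σ ^ ((F.a + 1) * n) = σ ^ n * σ ^ (F.a * n) := by rw [← pow_add]; congr 1; ring
  have hσn : 1 ≤ σ ^ n := Nat.one_le_pow n σ hσ
  have han : σ ^ (F.a * n) ≤ σ ^ ((F.a + 1) * n) := by rw [hpow]; exact Nat.le_mul_of_pos_left _ (by omega)
  unfold NA₁
  rw [hS, hpow]
  nlinarith [h1, h2, h3, h4, hσn]

/-- `NA₂ ≤ (4n + hdeg κ_D + 8n) σ^{an}`. [folklore] -/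
theorem NA₂_le {σ : ℕ} (hσ : 1 ≤ σ) (hexp : 1 + F.a * dd ≤ F.a * n) :
    F.NA₂ n dd hdeg σ ≤ (4 * n + hdeg * κD n dd + 8 * n) * σ ^ (F.a * n) := by
  have h2 := F.DT_le (hdeg := hdeg) hσ hexp
  unfold NA₂ T at *
  nlinarith [h2]

/-- `L₁ ≤ c · σ^{(a+1)n}` with `c = 4n + 3 + κ_D + (nℓ+1)(hdeg κ_D + 4n)`. [folklore] -/
theorem L₁_le (hn : 1 ≤ n) {σ : ℕ} (hσ : 1 ≤ σ) (hexp : 1 + F.a * dd ≤ F.a * n) :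
    F.L₁ n dd hdeg σ ≤ (4 * n + 3 + κD n dd + (n * F.ℓ + 1) * (hdeg * κD n dd + 4 * n)) * σ ^ ((F.a + 1) * n) := by
  have h1 := F.T'_le hn hσ
  have h2 := F.P₁_le (hdeg := hdeg) hn hσ hexp
  have h3 : F.Dn n dd σ ≤ κD n dd * σ ^ (F.a * n) := by rw [F.Dn_eq]; exact Nat.mul_le_mul_left _ (F.pow_D_le hσ hexp)
  have hS := F.S₁_add_one_le (n := n) hσ
  have hpow : σ ^ ((F.a + 1) * n) = σ ^ n * σ ^ (F.a * n) := by rw [← pow_add]; congr 1; ring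
  have hσn : 1 ≤ σ ^ n := Nat.one_le_pow n σ hσ
  have hσan : 1 ≤ σ ^ (F.a * n) := Nat.one_le_pow _ σ hσ
  unfold L₁
  rw [hpow]
  nlinarith [h1, h2, h3, hS, hσn, hσan]

/-- `L₂ ≤ (4n + 3n + hdeg κ_D + 4n) σ^{an}`. [folklore] -/
theorem L₂_le (hn : 1 ≤ n) {σ : ℕ} (hσ : 1 ≤ σ) (hexp : 1 + F.a * dd ≤ F.a * n) :
    F.L₂ n dd hdeg σ ≤ (4 * n + 3 * n + hdeg * κD n dd + 4 * n) * σ ^ (F.a * n) := by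
  have h1 := F.T'_le hn hσ
  have h2 := F.P₁_le (hdeg := hdeg) hn hσ hexp
  have hσan : 1 ≤ σ ^ (F.a * n) := Nat.one_le_pow _ σ hσ
  unfold L₂
  nlinarith [h1, h2, hσan]

/-! ### The three sub-dominant terms -/

/-- The growth term: `D·(1 + (R'+1)² G'²) ≤ σ^{(a+1)n}` once `a·dd + 2b + n + 2 ≤ a·n` and
`σ ≥ κ_D (1 + (2nℓ+3)² G'²)`. [folklore] -/
theorem growthExp_le {σ : ℕ} (hσ : 1 ≤ σ) (hdeg' : F.a * dd + 2 * F.b + n + 2 ≤ F.a * n)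
    (hσc : κD n dd * (1 + (2 * (n * F.ℓ) + 3) ^ 2 * G' ^ 2) ≤ σ) :
    F.Dn n dd σ * (1 + (F.R' n σ + 1) ^ 2 * G' ^ 2) ≤ σ ^ ((F.a + 1) * n) := by
  have hσbn : 1 ≤ σ ^ (F.b + n) := Nat.one_le_pow _ σ hσ
  have hR : F.R' n σ + 1 ≤ (2 * (n * F.ℓ) + 3) * σ ^ (F.b + n) := by
    unfold R'; nlinarith
  have h1 : 1 + (F.R' n σ + 1) ^ 2 * G' ^ 2 ≤ (1 + (2 * (n * F.ℓ) + 3) ^ 2 * G' ^ 2) * (σ ^ (F.b + n)) ^ 2 := by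
    have := Nat.mul_le_mul (Nat.pow_le_pow_left hR 2) (le_refl (G' ^ 2))
    have h2 : 1 ≤ (σ ^ (F.b + n)) ^ 2 := Nat.one_le_pow _ _ hσbn
    nlinarith [this, h2]
  rw [F.Dn_eq]
  calc κD n dd * σ ^ (1 + F.a * dd) * (1 + (F.R' n σ + 1) ^ 2 * G' ^ 2)
      ≤ κD n dd * σ ^ (1 + F.a * dd) * ((1 + (2 * (n * F.ℓ) + 3) ^ 2 * G' ^ 2) * (σ ^ (F.b + n)) ^ 2) :=
        Nat.mul_le_mul_left _ h1
    _ = (κD n dd * (1 + (2 * (n * F.ℓ) + 3) ^ 2 * G' ^ 2)) * σ ^ (1 + F.a * dd + 2 * (F.b + n)) := by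
        rw [pow_add σ (1 + F.a * dd), ← pow_mul]; ring
    _ ≤ σ * σ ^ (1 + F.a * dd + 2 * (F.b + n)) := Nat.mul_le_mul_right _ hσc
    _ = σ ^ (1 + F.a * dd + 2 * (F.b + n) + 1) := by ring
    _ ≤ σ ^ ((F.a + 1) * n) := Nat.pow_le_pow_right hσ (by nlinarith [hdeg'])

/-- The right-hand-side term: `Y = D·(2 + S₁²) ≤ σ^{(a+1)n}` once `a·dd + n + 2 ≤ a·n` and
`σ ≥ κ_D (2 + (nℓ)²)`. [folklore] -/
theorem Y_le {σ : ℕ} (hσ : 1 ≤ σ) (hdeg' : F.a * dd + n + 2 ≤ F.a * n) (hσc : κD n dd * (2 + (n * F.ℓ) ^ 2) ≤ σ) :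
    F.Y n dd σ ≤ σ ^ ((F.a + 1) * n) := by
  have hσn : 1 ≤ σ ^ n := Nat.one_le_pow _ σ hσ
  have hS : F.S₁ n σ = n * F.ℓ * σ ^ n := by unfold S₁ S; ring
  have h1 : 2 + F.S₁ n σ ^ 2 ≤ (2 + (n * F.ℓ) ^ 2) * (σ ^ n) ^ 2 := by
    rw [hS]; nlinarith [Nat.one_le_pow 2 _ hσn]
  unfold Y
  rw [F.Dn_eq]
  calc κD n dd * σ ^ (1 + F.a * dd) * (2 + F.S₁ n σ ^ 2)
      ≤ κD n dd * σ ^ (1 + F.a * dd) * ((2 + (n * F.ℓ) ^ 2) * (σ ^ n) ^ 2) := Nat.mul_le_mul_left _ h1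
    _ = (κD n dd * (2 + (n * F.ℓ) ^ 2)) * σ ^ (1 + F.a * dd + 2 * n) := by rw [pow_add σ (1 + F.a * dd), ← pow_mul]; ring
    _ ≤ σ * σ ^ (1 + F.a * dd + 2 * n) := Nat.mul_le_mul_right _ hσc
    _ = σ ^ (1 + F.a * dd + 2 * n + 1) := by ring
    _ ≤ σ ^ ((F.a + 1) * n) := Nat.pow_le_pow_right hσ (by nlinarith [hdeg'])

/-- The `W`-exponent term: `(an+1)·X₂ ≤ σ^{(a+1)n}` once `σ ≥ (an+1)·c₈`,
`c₈ = 4n + 3n + h(11n + hdeg κ_D) + h(12n + hdeg κ_D)`. [folklore] -/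
theorem X₂_le (hn : 1 ≤ n) {σ : ℕ} (hσ : 1 ≤ σ) (hexp : 1 + F.a * dd ≤ F.a * n)
    (hσc : (F.a * n + 1) * (4 * n + 3 * n + h * (4 * n + 3 * n + hdeg * κD n dd + 4 * n) +
      h * (4 * n + hdeg * κD n dd + 8 * n)) ≤ σ) :
    (F.a * n + 1) * F.X₂ n dd h hdeg σ ≤ σ ^ ((F.a + 1) * n) := by
  have h1 := F.T'_le hn hσ
  have h2 := F.L₂_le (hdeg := hdeg) hn hσ hexp
  have h3 := F.NA₂_le (hdeg := hdeg) hσ hexp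
  have hσan : 1 ≤ σ ^ (F.a * n) := Nat.one_le_pow _ σ hσ
  have hX : F.X₂ n dd h hdeg σ ≤ (4 * n + 3 * n + h * (4 * n + 3 * n + hdeg * κD n dd + 4 * n) +
      h * (4 * n + hdeg * κD n dd + 8 * n)) * σ ^ (F.a * n) := by
    unfold X₂
    have h2' := Nat.mul_le_mul_left (h - 1) h2
    have h3' := Nat.mul_le_mul_left h h3
    have hh : h - 1 ≤ h := Nat.sub_le h 1
    nlinarith [h1, h2', h3', hσan, hh]
  have hpow : σ ^ ((F.a + 1) * n) = σ ^ n * σ ^ (F.a * n) := by rw [← pow_add]; congr 1; ring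
  have hσn : σ ≤ σ ^ n := by
    calc σ = σ ^ 1 := (pow_one σ).symm
      _ ≤ σ ^ n := Nat.pow_le_pow_right hσ hn
  calc (F.a * n + 1) * F.X₂ n dd h hdeg σ
      ≤ (F.a * n + 1) * ((4 * n + 3 * n + h * (4 * n + 3 * n + hdeg * κD n dd + 4 * n) +
          h * (4 * n + hdeg * κD n dd + 8 * n)) * σ ^ (F.a * n)) := Nat.mul_le_mul_left _ hX
    _ = ((F.a * n + 1) * (4 * n + 3 * n + h * (4 * n + 3 * n + hdeg * κD n dd + 4 * n) +
          h * (4 * n + hdeg * κD n dd + 8 * n))) * σ ^ (F.a * n) := by ring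
    _ ≤ σ * σ ^ (F.a * n) := Nat.mul_le_mul_right _ hσc
    _ ≤ σ ^ n * σ ^ (F.a * n) := Nat.mul_le_mul_right _ hσn
    _ = σ ^ ((F.a + 1) * n) := hpow.symm

/-! ### The exponent inequality -/

/-- **The exponent inequality of the numerical condition along the family.** For `n ≥ 1`,
`dd < n`, `b ≥ b₀(h, n, ℓ, hdeg, dd)`, `a·(n - dd) ≥ 2b + 2n + 4` (given as
`a·dd + 2b + 2n + 4 ≤ a·n`) and `σ` beyond three explicit thresholds:
`X₁ + (an+1)·X₂ + Y < b·(T - T')·(S₀+1)`. [cite: BakerWustholz2007, §6.8 (p. 119)] -/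
theorem exponent_ineq (hn : 1 ≤ n) (ha : F.a * dd + 2 * F.b + 2 * n + 4 ≤ F.a * n)
    (hb : b₀ F n dd h hdeg ≤ F.b) {σ : ℕ} (hσ : 1 ≤ σ)
    (hσ1 : κD n dd * (1 + (2 * (n * F.ℓ) + 3) ^ 2 * G' ^ 2) ≤ σ)
    (hσ2 : κD n dd * (2 + (n * F.ℓ) ^ 2) ≤ σ)
    (hσ3 : (F.a * n + 1) * (4 * n + 3 * n + h * (4 * n + 3 * n + hdeg * κD n dd + 4 * n) +
      h * (4 * n + hdeg * κD n dd + 8 * n)) ≤ σ) :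
    F.X₁ n dd h hdeg G' σ + (F.a * n + 1) * F.X₂ n dd h hdeg σ + F.Y n dd σ < F.b * F.Msave n σ := by
  have hexp : 1 + F.a * dd ≤ F.a * n := by omega
  set N := σ ^ ((F.a + 1) * n) with hN
  have hpow : N = σ ^ n * σ ^ (F.a * n) := by rw [hN, ← pow_add]; congr 1; ring
  have hσn : 1 ≤ σ ^ n := Nat.one_le_pow _ σ hσ
  have hσan : 1 ≤ σ ^ (F.a * n) := Nat.one_le_pow _ σ hσ
  have hN1 : 1 ≤ N := Nat.one_le_pow _ σ hσ
  have han : σ ^ (F.a * n) ≤ N := by rw [hpow]; exact Nat.le_mul_of_pos_left _ (by omega)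
  -- the pieces
  have t1 : 2 * F.T' n σ ≤ 4 * n * N := by
    calc 2 * F.T' n σ ≤ 2 * (2 * n * σ ^ (F.a * n)) := Nat.mul_le_mul_left _ (F.T'_le hn hσ)
      _ = 4 * n * σ ^ (F.a * n) := by ring
      _ ≤ 4 * n * N := Nat.mul_le_mul_left _ han
  have t2 := F.growthExp_le (G' := G') hσ (by omega) hσ1
  have t3 : h * ((F.S₁ n σ + 1) * F.E' n dd hdeg σ) ≤ h * (n * F.ℓ + 1) * ((2 + hdeg) * κD n dd + 10 * n) * N := by
    have hS := F.S₁_add_one_le (n := n) hσ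
    have hE := F.E'_le (hdeg := hdeg) hn hσ hexp
    have := Nat.mul_le_mul hS hE
    calc h * ((F.S₁ n σ + 1) * F.E' n dd hdeg σ)
        ≤ h * (((n * F.ℓ + 1) * σ ^ n) * (((2 + hdeg) * κD n dd + 10 * n) * σ ^ (F.a * n))) :=
          Nat.mul_le_mul_left _ this
      _ = h * (n * F.ℓ + 1) * ((2 + hdeg) * κD n dd + 10 * n) * N := by rw [hpow]; ring
  have t4 : (h - 1) * F.L₁ n dd hdeg σ ≤ h * (4 * n + 3 + κD n dd + (n * F.ℓ + 1) * (hdeg * κD n dd + 4 * n)) * N := by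
    have hL := F.L₁_le (hdeg := hdeg) hn hσ hexp
    have hh : h - 1 ≤ h := Nat.sub_le h 1
    calc (h - 1) * F.L₁ n dd hdeg σ ≤ h * F.L₁ n dd hdeg σ := Nat.mul_le_mul_right _ hh
      _ ≤ h * ((4 * n + 3 + κD n dd + (n * F.ℓ + 1) * (hdeg * κD n dd + 4 * n)) * N) := Nat.mul_le_mul_left _ hL
      _ = _ := by ring
  have t5 : h * F.NA₁ n dd hdeg σ ≤ h * ((2 + hdeg) * κD n dd + 20 * n + 8 * n + κD n dd + hdeg * κD n dd + 8 * n) * N := by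
    have := F.NA₁_le (hdeg := hdeg) hσ hexp
    calc h * F.NA₁ n dd hdeg σ ≤ h * (((2 + hdeg) * κD n dd + 20 * n + 8 * n + κD n dd + hdeg * κD n dd + 8 * n) * N) :=
          Nat.mul_le_mul_left _ this
      _ = _ := by ring
  have t6 := F.X₂_le (h := h) (hdeg := hdeg) hn hσ hexp hσ3
  have t7 := F.Y_le hσ (by omega) hσ2
  -- the sum is at most `b₀ · N ≤ b · N`
  have t0 : 3 ≤ 3 * N := by simpa using Nat.mul_le_mul_left 3 hN1
  have hsum : F.X₁ n dd h hdeg G' σ + (F.a * n + 1) * F.X₂ n dd h hdeg σ + F.Y n dd σ ≤ b₀ F n dd h hdeg * N := by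
    have e1 : F.X₁ n dd h hdeg G' σ + (F.a * n + 1) * F.X₂ n dd h hdeg σ + F.Y n dd σ =
        2 * F.T' n σ + 3 + F.Dn n dd σ * (1 + (F.R' n σ + 1) ^ 2 * G' ^ 2) +
          h * ((F.S₁ n σ + 1) * F.E' n dd hdeg σ) + (h - 1) * F.L₁ n dd hdeg σ + h * F.NA₁ n dd hdeg σ +
          (F.a * n + 1) * F.X₂ n dd h hdeg σ + F.Y n dd σ := by
      unfold X₁; ring
    have e2 : b₀ F n dd h hdeg * N = 4 * n * N + 3 * N + N +
        h * (n * F.ℓ + 1) * ((2 + hdeg) * κD n dd + 10 * n) * N +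
        h * (4 * n + 3 + κD n dd + (n * F.ℓ + 1) * (hdeg * κD n dd + 4 * n)) * N +
        h * ((2 + hdeg) * κD n dd + 20 * n + 8 * n + κD n dd + hdeg * κD n dd + 8 * n) * N + N + N := by
      unfold b₀; ring
    rw [e1, e2]
    exact Nat.add_le_add (Nat.add_le_add (Nat.add_le_add (Nat.add_le_add (Nat.add_le_add (Nat.add_le_add
      (Nat.add_le_add t1 t0) t2) t3) t4) t5) t6) t7
  -- and `b · N < b · Msave`
  have hM : 2 * n * N ≤ F.Msave n σ := by
    have := F.two_n_pow_le_T_sub hn hσ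
    calc 2 * n * N = (2 * n * σ ^ (F.a * n)) * σ ^ n := by rw [hpow]; ring
      _ ≤ (F.T n σ - F.T' n σ) * σ ^ n := Nat.mul_le_mul_right _ this
      _ = F.Msave n σ := by unfold Msave; rw [S₀_add_one n hσ]
  have hb1 : 1 ≤ F.b := le_trans (by unfold b₀; omega) hb
  calc F.X₁ n dd h hdeg G' σ + (F.a * n + 1) * F.X₂ n dd h hdeg σ + F.Y n dd σ ≤ b₀ F n dd h hdeg * N := hsum
    _ ≤ F.b * N := Nat.mul_le_mul_right _ hb
    _ < F.b * (2 * n * N) := by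
        have : N < 2 * n * N := by
          calc N = 1 * N := (one_mul N).symm
            _ < 2 * n * N := Nat.mul_lt_mul_of_pos_right (by omega) (by omega)
        exact Nat.mul_lt_mul_of_pos_left this (by omega)
    _ ≤ F.b * F.Msave n σ := Nat.mul_le_mul_left _ hM

end Family

end BakerData

end Std

end GaGmE

end Literature.NumberTheory.Transcendental
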